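import Mathlib
import HarnessLib

/-!
# Item `LrcModEntire` (stmt-NavierStokesRegularity-20428) — (Q4) entrance: from the HOMOGENEOUS cross-section maximum to the inputs of the LEAD's Fermat-at-a-web-point

ns-k2-port-2 g5 (helper prover under the LEAD of item 20428, ns-poloidal-K2-p3 g14; `--supports stmt-NavierStokesRegularity-20428 --as helper`).
Glue between `…RidgeHullValues.exists_hullLimit_crossSectionMax_const` (the cross-section maximum over `[−r,r]` of `F τ = σU₂(−1+τ,·)` along the frame
`Ψ(s,n,z) = γ s + nν s + z e₂` does not depend on `s`) and `…RidgeWebEntrance.fderiv_uncurry_eq_of_ridgeWeb` (its `hle` / `heq` hypotheses).  Class-free; `F : ℝ → ℝ³ → ℝ` with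
continuous slices, the homogeneous maximum `R τ z := sSup ((n ↦ F τ (Ψ(0,n,z))) '' [−r,r])` by defining equation:

* `le_ridgeMax` — in the window `|τ|,|z| < δ`: `F τ (Ψ(s,n,z)) ≤ R τ z` for all `s` and `|n| ≤ r`;
* `exists_webPoint` — with strict cold lateral values (`F τ (Ψ(s,±r,z)) < m τ z ≤ F τ (Ψ(s,0,z))`, the (U-LL) of `…RidgeUniformLateral` for the limit profile) every cross-section
  carries an INTERIOR web point: `∃ n ∈ Ioo (−r) r, F τ (Ψ(s,n,z)) = R τ z` (the `heq` of the LEAD's lemma, with `q₀ = (s,n,z)`);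
* `eventually_le_ridgeMax` — at such a point the inequality holds for all nearby `(τ, s, n, z)`: the `hle` of the LEAD's lemma.

WHAT THIS IS NOT: not a claim about Navier–Stokes regularity — bookkeeping at the entrance of the research cell (Q4) on hypothetical profiles (bears_on LADDER-NS N0, item 20428 /
crux 19708; 20428/19708/27893 OPEN).  No summit statement is proved here.
-/

noncomputable section

-- the summit and its single sub-problem share the name (CONVENTIONS §1), as in every Theorems file
set_option linter.dupNamespace false

namespace Summit.NavierStokesRegularity.NavierStokesRegularity.Theorems.PoloidalWindowDoorLrcModEntireRidgeWebInputs

open Set Filter Topology Function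

variable {F : ℝ → EuclideanSpace ℝ (Fin 3) → ℝ} {γ ν : ℝ → EuclideanSpace ℝ (Fin 3)} {R m : ℝ → ℝ → ℝ} {r δ : ℝ}

/-- A cross-section `n ↦ F τ (Ψ(s,n,z))` is continuous, so its image of `[−r,r]` is compact (bounded above, `sSup` attained). -/
theorem isCompact_crossSection (hF : ∀ τ, Continuous (F τ)) (γ ν : ℝ → EuclideanSpace ℝ (Fin 3)) (τ s z r : ℝ) :
    IsCompact ((fun n : ℝ => F τ (γ s + n • ν s + z • EuclideanSpace.single 2 (1 : ℝ))) '' Icc (-r) r) :=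
  isCompact_Icc.image ((hF τ).comp (by fun_prop))

/-- **Every tube value is below the homogeneous cross-section maximum.** -/
theorem le_ridgeMax (hF : ∀ τ, Continuous (F τ))
    (hR : ∀ τ z, R τ z = sSup ((fun n : ℝ => F τ (γ 0 + n • ν 0 + z • EuclideanSpace.single 2 (1 : ℝ))) '' Icc (-r) r))
    (hconst : ∀ τ z : ℝ, |τ| < δ → |z| < δ → ∀ s : ℝ,
      sSup ((fun n : ℝ => F τ (γ s + n • ν s + z • EuclideanSpace.single 2 (1 : ℝ))) '' Icc (-r) r) =
        sSup ((fun n : ℝ => F τ (γ 0 + n • ν 0 + z • EuclideanSpace.single 2 (1 : ℝ))) '' Icc (-r) r))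
    {τ z : ℝ} (hτ : |τ| < δ) (hz : |z| < δ) (s : ℝ) {n : ℝ} (hn : n ∈ Icc (-r) r) :
    F τ (γ s + n • ν s + z • EuclideanSpace.single 2 (1 : ℝ)) ≤ R τ z := by
  rw [hR, ← hconst τ z hτ hz s]
  exact le_csSup (isCompact_crossSection hF γ ν τ s z r).bddAbove ⟨n, hn, rfl⟩

/-- **Every cross-section carries an interior web point** (strict cold lateral values and a hot centre). -/
theorem exists_webPoint (hF : ∀ τ, Continuous (F τ)) (hr : 0 < r)
    (hR : ∀ τ z, R τ z = sSup ((fun n : ℝ => F τ (γ 0 + n • ν 0 + z • EuclideanSpace.single 2 (1 : ℝ))) '' Icc (-r) r))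
    (hconst : ∀ τ z : ℝ, |τ| < δ → |z| < δ → ∀ s : ℝ,
      sSup ((fun n : ℝ => F τ (γ s + n • ν s + z • EuclideanSpace.single 2 (1 : ℝ))) '' Icc (-r) r) =
        sSup ((fun n : ℝ => F τ (γ 0 + n • ν 0 + z • EuclideanSpace.single 2 (1 : ℝ))) '' Icc (-r) r))
    (hlat : ∀ τ z : ℝ, |τ| < δ → |z| < δ → ∀ s n : ℝ, (n = r ∨ n = -r) → F τ (γ s + n • ν s + z • EuclideanSpace.single 2 (1 : ℝ)) < m τ z)
    (hmid : ∀ τ z : ℝ, |τ| < δ → |z| < δ → ∀ s : ℝ, m τ z ≤ F τ (γ s + z • EuclideanSpace.single 2 (1 : ℝ)))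
    {τ z : ℝ} (hτ : |τ| < δ) (hz : |z| < δ) (s : ℝ) :
    ∃ n ∈ Ioo (-r) r, F τ (γ s + n • ν s + z • EuclideanSpace.single 2 (1 : ℝ)) = R τ z := by
  have hK := isCompact_crossSection hF γ ν τ s z r
  have hne : ((fun n : ℝ => F τ (γ s + n • ν s + z • EuclideanSpace.single 2 (1 : ℝ))) '' Icc (-r) r).Nonempty := ⟨_, 0, ⟨by linarith, hr.le⟩, rfl⟩
  obtain ⟨n, hn, hneq⟩ := hK.sSup_mem hne
  have hneq' : F τ (γ s + n • ν s + z • EuclideanSpace.single 2 (1 : ℝ)) =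
      sSup ((fun n : ℝ => F τ (γ s + n • ν s + z • EuclideanSpace.single 2 (1 : ℝ))) '' Icc (-r) r) := hneq
  have hmax : F τ (γ s + n • ν s + z • EuclideanSpace.single 2 (1 : ℝ)) = R τ z := by rw [hneq', hconst τ z hτ hz s, ← hR]
  -- the maximiser is not lateral: lateral values are below the centre value, which is below the maximum
  have h0 : F τ (γ s + z • EuclideanSpace.single 2 (1 : ℝ)) ≤ R τ z := by
    have := le_ridgeMax hF hR hconst hτ hz s (n := 0) ⟨by linarith, hr.le⟩
    simpa using this
  have hnr : ¬ (n = r ∨ n = -r) := fun h => by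
    have := hlat τ z hτ hz s n h
    linarith [hmid τ z hτ hz s]
  push Not at hnr
  exact ⟨n, ⟨lt_of_le_of_ne hn.1 (Ne.symm hnr.2), lt_of_le_of_ne hn.2 hnr.1⟩, hmax⟩

/-- **The inequality near an interior web point** — the `hle` input of `…RidgeWebEntrance.fderiv_uncurry_eq_of_ridgeWeb` (with `q₀ = (s₀, n₀, z₀)`, `|n₀| < r`, `|τ₀|, |z₀| < δ`). -/
theorem eventually_le_ridgeMax (hF : ∀ τ, Continuous (F τ))
    (hR : ∀ τ z, R τ z = sSup ((fun n : ℝ => F τ (γ 0 + n • ν 0 + z • EuclideanSpace.single 2 (1 : ℝ))) '' Icc (-r) r))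
    (hconst : ∀ τ z : ℝ, |τ| < δ → |z| < δ → ∀ s : ℝ,
      sSup ((fun n : ℝ => F τ (γ s + n • ν s + z • EuclideanSpace.single 2 (1 : ℝ))) '' Icc (-r) r) =
        sSup ((fun n : ℝ => F τ (γ 0 + n • ν 0 + z • EuclideanSpace.single 2 (1 : ℝ))) '' Icc (-r) r))
    {τ₀ : ℝ} {q₀ : ℝ × ℝ × ℝ} (hτ₀ : |τ₀| < δ) (hn₀ : |q₀.2.1| < r) (hz₀ : |q₀.2.2| < δ) :
    ∀ᶠ p in 𝓝 ((τ₀, q₀) : ℝ × (ℝ × ℝ × ℝ)),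
      F p.1 (γ p.2.1 + p.2.2.1 • ν p.2.1 + p.2.2.2 • EuclideanSpace.single 2 (1 : ℝ)) ≤ R p.1 p.2.2.2 := by
  -- the window conditions are open
  have h1 : ∀ᶠ p in 𝓝 ((τ₀, q₀) : ℝ × (ℝ × ℝ × ℝ)), |p.1| < δ := by
    exact ((continuous_fst.abs).tendsto ((τ₀, q₀) : ℝ × (ℝ × ℝ × ℝ))).eventually_lt_const hτ₀
  have h2 : ∀ᶠ p in 𝓝 ((τ₀, q₀) : ℝ × (ℝ × ℝ × ℝ)), |p.2.2.1| < r := by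
    exact (((continuous_fst.comp (continuous_snd.comp continuous_snd)).abs).tendsto ((τ₀, q₀) : ℝ × (ℝ × ℝ × ℝ))).eventually_lt_const hn₀
  have h3 : ∀ᶠ p in 𝓝 ((τ₀, q₀) : ℝ × (ℝ × ℝ × ℝ)), |p.2.2.2| < δ := by
    exact (((continuous_snd.comp (continuous_snd.comp continuous_snd)).abs).tendsto ((τ₀, q₀) : ℝ × (ℝ × ℝ × ℝ))).eventually_lt_const hz₀
  filter_upwards [h1, h2, h3] with p hp1 hp2 hp3
  exact le_ridgeMax hF hR hconst hp1 hp3 p.2.1 ⟨(abs_lt.1 hp2).1.le, (abs_lt.1 hp2).2.le⟩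

end Summit.NavierStokesRegularity.NavierStokesRegularity.Theorems.PoloidalWindowDoorLrcModEntireRidgeWebInputs

end
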